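import Mathlib
import HarnessLib
import Summits.HubbardSuperconductivity.HubbardSuperconductivity.Theorems.KLProgrammeKLRegimeEngineV8TowerExports
import Summits.HubbardSuperconductivity.HubbardSuperconductivity.Theorems.KLProgrammeKLRegimeWickCarriersDefs
import Summits.HubbardSuperconductivity.HubbardSuperconductivity.Theorems.KLProgrammeKLRegimeWickDressedDefect

/-!
# Route `KLProgramme` — ENGINE child gen 8 (stmt-HubbardSuperconductivity-20437 `KLRegimeEngineV17F2`), SKELETON v2 (plan g17 (R47h), KL STATUS
# 2026-08-27T14:03:46Z): internal export class #5 «(S)-transfer» — `PairTransferAt`, its error shape `transferBarAt`, the step Prop and the deferred constant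
# (cell gate-hubbard-kl, seat hubbard-kl-p1 g11 = owner of the class-#5 TEXT; SHAPE to be signed off by the (c) v2 closer k3c2-p2 and the tower lane k3c1-p1 — DRAFT)

WHY (E2-GRIDPOINT-NOTE, evidence #23 on 20437; E2-STRUCTURE-NOTE; TRANSFER-NOTE §1–3).  Stub (c)'s door `pairLadderStepAtV17F2_of_wickTower_fwd` (p528604) needs,
at BOTH grid points of step `n`, a STRADDLE between the PLAIN slot array `klPairArrayF j` and the Wick object the tower runs on: `𝒞^W_j ≈ C_j·(1 − diag b·C_j)⁻¹` with a
GAINED error.  The plain↔Wick transfer `T_j = 𝒞^W_j − 𝒞_j` is `Θ(U²)` n-uniformly and absorbable only multiplicatively (through the weight `b`), which consumes the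
value-level pp-tree structure of the sextic kernel at scale `j` — a datum no slot of `klPredsV17F2` and no norm export carries.  (R47h): carry the straddle ITSELF as
a skeleton-internal induction invariant.  At step `n` the (c) v2 stub TAKES `PairTransferAt … (n−1)` (history) and PROVES `PairTransferAt … n` inside slice `n`,
where the sextic tree it needs is BORN (`∫Γ·Ċ·Γ`; `vertexFn_tadpole_dblFold_crossLaplacian`, p538407: its tadpole is the `(D_n, g_n)` mixed bubble — ladder-shaped).

* §1 `transferBarAt L G P r β U n Qm k k′ := r·((P.Klam·U)²·(phGain n |k−k′|_𝕋 + phGain n |k+k′−Qm|_𝕋 + 1/L) + (P.Klam·|U|)³·2^{−n} + thermalBar G P U β n)` — ONE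
  deferred constant `r` scaling the (E2-F2) budget SHAPES the transfer's non-ladder residue lives in (TRANSFER-NOTE §3: (i) the hard⊗soft ph bubbles at the two
  transfers = `phGain`-shaped, whose floor `16·4^{−n}` also carries every uniform `U²Λ_n` piece such as the soft-Hartree leg dressing; (ii) overlapping two-loop =
  CUBIC `(Klam|U|)³2^{−n}` — k3c2-p2's (q1) word: books in `eremBar`'s `CR`-slot raised by DefsQ8; finite-`L` Riemann slack; β-layer);
  `transferBarAt_nonneg`, `transferBarAt_mono` (in `r`).
* §1 THE INDUCTION-CARRYING FORM (recommended, (q6′)): `IsSoftSubCov β μ K n D` (normal `D` with symbol a pointwise fraction `φ ∈ [0, 1 − w^K_{Λ_n}]` of the zero-seed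
  propagator symbol), `klCovSmearedPairAmplitude … K n D := 𝒱₄(e^{Δ_D}𝒱_n[K])`, **`PairTransferAtCov … n D`**, **`PairTransferFamilyCov … n := ∀ D admissible at (K_n, n)`**
  ⊇ the `D_m` members (`isSoftSubCov_klSoftCov`), the door's member (`.pairTransferAt`), the plain member (`isSoftSubCov_zero`, `klCovSmearedPairAmplitude_zero`) AND
  the GAPPED members `D″ + g_{n+1}` (`D″` admissible at scale `n+1`) which the step produces: `𝒱₄(e^{Δ_{D″}}𝒱_{n+1}) = 𝒱₄(e^{Δ_{D″+g_{n+1}}}𝒱_n) − ½𝒱₄(dblFold(…)) +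
  𝒱₄(e^{Δ_{D″}}R₃)` (`wickStep_cross`, p524233) — the step-`(n+1)` producer never UN-smears (no tadpole of an inherited sextic is ever read), it only reads the
  scale-`n` family at `D″ + g_{n+1}` (admissible at scale `n`: `φ″ + (w_{Λ_{n+1}} − w_{Λ_n}) ≤ 1 − w_{Λ_n}`) plus slice-born terms and norms.
* §1 THE MINIMAL carried sub-family (KL STATUS 15:04Z (3)): the COMPLEMENTARY members `D_n − D_m = C^K_{(Λ_m, Λ_n]}`, `m ≥ n` (`isSoftSubCov_softCov_sub`;
  `m = n`: plain, `m` past the thermal scale: Wick), **`PairTransferFamilyHard`** (⊂ `PairTransferFamilyCov`, `.hard`); closure with the SAME index under the step,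
  `klSoftCov_succ_sub_add_slice`: `(D_{n+1} − D_m) + g_{n+1} = D_n − D_m` — the step-`(n+1)` member of index `m` is produced from the scale-`n` member of index `m`
  by a Wick tower whose total covariance is `D_n − D_m` (no straddle, no un-smearing).
* §1 **`PairTransferAt L M G P r β U μ n`** — for every pair class `Qm` at resolution `n`: `∃ t` (the transfer weight, in the DOOR's sign convention
  `(1 − diag t·C)·M = 1`, so `t = −τ_n ≤ 0` at leading order, `τ_n = 2h_n(1−h_n)·|ĝĝ| ≥ 0` the mixed-bubble profile) with MASS `Σ|t| ≤ G.bhi/4`, near-NONPOSITIVITY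
  `Σ(|t| + t) ≤ klEdge G n |Qm|_𝕋` (exactly `0` at `Qm = 0`), and `∃ M, (1 − diagonal t·klPairArrayF n Qm)·M = 1 ∧ ∀ k k′ ∈ klBall μ 0,
  ‖klWickPairAmplitude (K_n) n Qm k k′ − (klPairArrayF n Qm·M) k k′‖ ≤ transferBarAt … n Qm k k′`.  WHY THESE TWO SIGN/MASS CLAUSES SUFFICE FOR THE DOOR (its
  composite weight is `w₁ + b − b′`, `b′ := t_{n−1}` from HISTORY, `b := t_n` and `w₁` produced TOGETHER inside slice `n`): by subadditivity of the negative part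
  (`sum_negPart_add_le`), `Σ(|w₁+b−b′| − (w₁+b−b′)) ≤ Σ(|w₁+b| − (w₁+b)) + Σ(|b′| + b′)` — the first summand is a SAME-SCALE quantity (on the scale-`n` transition
  shell `Z_n − τ_n = h_n² ≥ 0` exactly, TRANSFER-NOTE §1, with one common dressing factor), the second is the history's near-nonpositivity clause; masses add
  (`sum_abs_add_sub_le`).  No cross-scale pointwise matching is ever needed.
* §2 the STEP Prop **`PairTransferStep P R Q₀ r u`** — binders = `LevelsUStep`'s (p5, `…EngineV8TowerExports`), hypotheses `HistP klPredsV17F2 … (Q₀.withCR rr) … n`,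
  `FrameOK … (K_n)`, the norm exports `∀ j ≤ n, LevelsUExportAt L M (klCU P R Q₀) P β U μ j` (class #1's deferred table, as in k3c2-p2's `IsoTupleLineStep`) and the transfer history `∀ j < n,
  PairTransferFamilyCov … j` ⟹ `PairTransferFamilyCov … n` (the FAMILY over admissible smearing covariances; its member `D = D_n` is the door's `PairTransferAt`,
  `PairTransferFamilyCov.pairTransferAt`; the minimal sub-family `PairTransferFamilyHard` is what the step towers consume).  At `n = 0` the transfer history is empty: the scale-`0` transfer (`D_0`-tadpoles of the ultraviolet sextic) is an obligation of the
  scale-`0` lane (E2-WICK-ROADMAP §4).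
* §3 the DEFERRED constant `klCT P R Q₀` / threshold `klCTu P R Q₀` behind ONE `∃ + dite` ((R47b) principle), `klCT_nonneg`, `klCTu_pos` (unconditional),
  `pairTransferStep_klCT_of_exists/_of`.
CARRIERS ((R47h)(2)): stated on the PLAIN public array `klPairArrayF` vs the WICK amplitude at the flow frame `K_n` — the class is the plain↔Wick bridge itself, so the
carrier question does not arise for it.  Definitions with bodies + bookkeeping lemmas; nothing about the model is asserted; nothing asserts superconductivity.  0 kit.
-/

noncomputable section

namespace Summit.HubbardSuperconductivity.HubbardSuperconductivity.Theorems.KLRegimeSplit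

set_option linter.dupNamespace false -- summit = problem name (single-conjunct summit), D-0017

open Real Finset Literature.MathematicalPhysics.QuantumLattice Literature.Probability.LatticeModels
open Literature.MathematicalPhysics.QuantumLattice.FermiRG
open Summit.HubbardSuperconductivity.HubbardSuperconductivity.Theorems.KLProgrammeLegKernels
open Summit.HubbardSuperconductivity.HubbardSuperconductivity.Theorems.DispersionFlow
open Summit.HubbardSuperconductivity.HubbardSuperconductivity.Theorems.EngineV8
open Summit.HubbardSuperconductivity.HubbardSuperconductivity.Theorems.KLRegimeWick

/-! ## §1 The error shape and the transfer clause -/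

section Model

variable (L M : ℕ) [NeZero L]

/-- **`transferBarAt`** — the transfer's non-ladder residue allowance at the pair labels `(k, k′)` of the class `Qm`, scale `n`: `r` times the (E2-F2) budget
shapes `(P.Klam·U)²·(phGain n |k−k′|_𝕋 + phGain n |k+k′−Qm|_𝕋 + 1/L) + (P.Klam·|U|)³·2^{−n} + thermalBar G P U β n` (cubic uniform part: k3c2-p2 (q1)). -/
def transferBarAt (G : GeoConsts) (P : SplitConsts) (r β U : ℝ) (n : ℕ) (Qm k k' : TorusSite 2 L) : ℝ :=
  r * ((P.Klam * U) ^ 2 * (G.phGain n (klTorusNorm L (k - k')) + G.phGain n (klTorusNorm L (k + k' - Qm)) + ((L : ℝ))⁻¹) +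
    (P.Klam * |U|) ^ 3 * ((2 : ℝ) ^ n)⁻¹ + thermalBar G P U β n)

omit [NeZero L] in
variable {L} in
/-- The bracket of `transferBarAt` is nonnegative for a well-formed geometry package (`0 ≤ phGain`, `0 ≤ CF`). -/
theorem transferBarAt_bracket_nonneg {G : GeoConsts} (hph : ∀ n ρ, 0 ≤ G.phGain n ρ) (hCF : 0 ≤ G.CF) {P : SplitConsts} (hK : 0 ≤ P.Klam) (β U : ℝ)
    (n : ℕ) (Qm k k' : TorusSite 2 L) :
    0 ≤ (P.Klam * U) ^ 2 * (G.phGain n (klTorusNorm L (k - k')) + G.phGain n (klTorusNorm L (k + k' - Qm)) + ((L : ℝ))⁻¹) +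
      (P.Klam * |U|) ^ 3 * ((2 : ℝ) ^ n)⁻¹ + thermalBar G P U β n := by
  have h1 := hph n (klTorusNorm L (k - k'))
  have h2 := hph n (klTorusNorm L (k + k' - Qm))
  have h3 : 0 ≤ thermalBar G P U β n := by unfold thermalBar; positivity
  have h4 : 0 ≤ P.Klam * |U| := mul_nonneg hK (abs_nonneg U)
  positivity

omit [NeZero L] in
variable {L} in
/-- `transferBarAt` is nonnegative for `0 ≤ r`. -/
theorem transferBarAt_nonneg {G : GeoConsts} (hph : ∀ n ρ, 0 ≤ G.phGain n ρ) (hCF : 0 ≤ G.CF) {P : SplitConsts} (hK : 0 ≤ P.Klam) {r : ℝ} (hr : 0 ≤ r)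
    (β U : ℝ) (n : ℕ) (Qm k k' : TorusSite 2 L) : 0 ≤ transferBarAt L G P r β U n Qm k k' :=
  mul_nonneg hr (transferBarAt_bracket_nonneg hph hCF hK β U n Qm k k')

omit [NeZero L] in
variable {L} in
/-- `transferBarAt` is monotone in `r`. -/
theorem transferBarAt_mono {G : GeoConsts} (hph : ∀ n ρ, 0 ≤ G.phGain n ρ) (hCF : 0 ≤ G.CF) {P : SplitConsts} (hK : 0 ≤ P.Klam) {r r' : ℝ} (hr : r ≤ r')
    (β U : ℝ) (n : ℕ) (Qm k k' : TorusSite 2 L) : transferBarAt L G P r β U n Qm k k' ≤ transferBarAt L G P r' β U n Qm k k' :=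
  mul_le_mul_of_nonneg_right hr (transferBarAt_bracket_nonneg hph hCF hK β U n Qm k k')

variable [NeZero M]

/-- **Admissible smearing covariances at frame `K`, scale `n`**: the normal covariances whose symbol is a pointwise FRACTION `φ ∈ [0, 1 − w^K_{Λ_n}]` of the
zero-seed propagator symbol `βL²(iω + ξ_K)/nambuDen` — the soft covariance `D^K_n` itself (`φ = 1 − w^K_{Λ_n}`, `klw_softCov_eq_normalCovariance`), every softer
`D^K_m`, `m ≥ n` (`isSoftSubCov_klSoftCov`), `0` (`isSoftSubCov_zero`), and the GAPPED sums `D″ + g_{n+1}` (`D″` admissible at scale `n+1`) that the step produces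
(`e^{Δ_{D″}}∘effAction g_{n+1} = e^{Δ_{D″+g_{n+1}}} + …`, `wickStep_cross`) — the reason the induction carries the family over ALL of them. -/
def IsSoftSubCov (β μ : ℝ) (K : TrigPolyC4v) (n : ℕ) (D : Matrix (HubbardFieldIdx L M) (HubbardFieldIdx L M) ℂ) : Prop :=
  ∃ φ : FreqMomentum L M × Fin 2 → ℝ, (∀ ks, 0 ≤ φ ks ∧ φ ks ≤ 1 - hubbardCutoffWeightCT L M β μ K (klScale klE0 n) ks.1) ∧
    D = normalCovariance L M (fun ks => (φ ks : ℂ) *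
      (((β * (L : ℝ) ^ 2 : ℝ) : ℂ) * ((Complex.I * matsubaraFreq β M ks.1.1 + nambuXiCT L μ K ks.1.2) / nambuDenCT L M β μ 0 K ks.1)))

/-- **The `D`-smeared pair amplitude of the scale-`n` action** at frame `K`: `𝒱₄(e^{Δ_D}𝒱_n[K])` at the pair labels — the WICK amplitude `𝒞^W_n` is the member
`D = D^K_n` (`klCovSmearedPairAmplitude_klSoftCov_self`), the PLAIN `𝒞_n` the member `D = 0` (`klCovSmearedPairAmplitude_zero`). -/
def klCovSmearedPairAmplitude (β U μ : ℝ) (K : TrigPolyC4v) (n : ℕ) (D : Matrix (HubbardFieldIdx L M) (HubbardFieldIdx L M) ℂ)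
    (Q k k' : TorusSite 2 L) : ℂ :=
  vertexFn L M β (gaussConv ℂ D (klEffectiveAction L M β U μ K klE0 n)) 4
    ![(((omega0 M, k'), 0), 0), ((((omega0 M).rev, Q - k'), 1), 0), ((((omega0 M).rev, Q - k), 1), 1), (((omega0 M, k), 0), 1)]

/-- The member `D = D^K_n` is the WICK pair amplitude `𝒞^W_n` (`rfl`). -/
theorem klCovSmearedPairAmplitude_klSoftCov_self (β U μ : ℝ) (K : TrigPolyC4v) (n : ℕ) (Q k k' : TorusSite 2 L) :
    klCovSmearedPairAmplitude L M β U μ K n (klSoftCov L M β μ K n) Q k k' = klWickPairAmplitude L M β U μ K n Q k k' := rfl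

omit [NeZero L] [NeZero M] in
/-- Past the thermal scale the smearing by `D^K_m` is trivial (`klw_softCov_eq_zero_of_lt`): the member `D = D^K_n − D^K_m` is then the WICK amplitude. -/
theorem klSoftCov_sub_eq_self_of_lt {β : ℝ} (hβ : 0 < β) (μ : ℝ) (K : TrigPolyC4v) (n : ℕ) {m : ℕ} (hm : nScales β < m) :
    klSoftCov L M β μ K n - klSoftCov L M β μ K m = klSoftCov L M β μ K n := by
  rw [klw_softCov_eq_zero_of_lt L M hβ hm μ K, sub_zero]

/-- The member `D = 0` is the PLAIN pair amplitude. -/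
theorem klCovSmearedPairAmplitude_zero (β U μ : ℝ) (K : TrigPolyC4v) (n : ℕ) (Q k k' : TorusSite 2 L) :
    klCovSmearedPairAmplitude L M β U μ K n 0 Q k k' = klPairAmplitude L M β U μ K n Q k k' := by
  rw [klCovSmearedPairAmplitude, klPairAmplitude, gaussConv_zero, Module.End.one_apply]

omit [NeZero L] [NeZero M] in
/-- The zero covariance is admissible (`φ = 0`). -/
theorem isSoftSubCov_zero (β μ : ℝ) (K : TrigPolyC4v) (n : ℕ) : IsSoftSubCov L M β μ K n 0 := by
  refine ⟨fun _ => 0, fun ks => ⟨le_rfl, ?_⟩, ?_⟩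
  · have h : hubbardCutoffWeightCT L M β μ K (klScale klE0 n) ks.1 ≤ 1 := (salmhoferCutoff_mem_Icc _).2
    linarith
  · ext X Y
    simp [normalCovariance_apply]

omit [NeZero M] in
/-- **Every softer soft covariance is admissible**: `D^K_m`, `m ≥ n` (`φ = 1 − w^K_{Λ_m} ≤ 1 − w^K_{Λ_n}`, the weight above scale being antitone in the scale). -/
theorem isSoftSubCov_klSoftCov (β μ : ℝ) (K : TrigPolyC4v) {n m : ℕ} (hnm : n ≤ m) : IsSoftSubCov L M β μ K n (klSoftCov L M β μ K m) := by
  refine ⟨fun ks => 1 - hubbardCutoffWeightCT L M β μ K (klScale klE0 m) ks.1, fun ks => ⟨?_, ?_⟩, ?_⟩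
  · have h : hubbardCutoffWeightCT L M β μ K (klScale klE0 m) ks.1 ≤ 1 := (salmhoferCutoff_mem_Icc _).2
    linarith
  · -- `w_{Λ_n} ≤ w_{Λ_m}` since `Λ_m ≤ Λ_n`
    have hE0 : (0 : ℝ) ≤ klE0 := by
      have h0 := klth_klScale_pos 0
      unfold klScale at h0
      simpa using h0.le
    have hΛ : klScale klE0 m ≤ klScale klE0 n := by
      unfold klScale
      exact mul_le_mul_of_nonneg_left (inv_anti₀ (by positivity) (pow_le_pow_right₀ (by norm_num) hnm)) hE0
    have hw : hubbardCutoffWeightCT L M β μ K (klScale klE0 n) ks.1 ≤ hubbardCutoffWeightCT L M β μ K (klScale klE0 m) ks.1 := by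
      unfold hubbardCutoffWeightCT
      refine monotone_salmhoferCutoff ?_
      have hE : 0 ≤ matsubaraFreq β M ks.1.1 ^ 2 + nambuXiCT L μ K ks.1.2 ^ 2 := by positivity
      exact div_le_div_of_nonneg_left hE (by have := klth_klScale_pos m; positivity) (pow_le_pow_left₀ (klth_klScale_pos m).le hΛ 2)
    linarith
  · rw [klw_softCov_eq_normalCovariance]
    congr 1
    funext ks
    push_cast
    ring

/-- **`PairTransferAtCov L M G P r β U μ n D`** — the transfer clause at a smearing covariance `D`: for every pair class `Qm` at resolution `n`, a transfer weight `t`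
(door sign convention `(1 − diag t·C)·M = 1`; `t ≤ 0` up to the edge) of mass `≤ G.bhi/4` and near-NONPOSITIVITY `Σ(|t| + t) ≤ klEdge G n |Qm|_𝕋`, a two-sided inverse `M`
of `1 − diag t·klPairArrayF n Qm`, and ON THE BARE BALL `‖𝒱₄(e^{Δ_D}𝒱_n[K_n])(Qm;k,k′) − (klPairArrayF n Qm·M) k k′‖ ≤ transferBarAt … n Qm k k′`. -/
def PairTransferAtCov (G : GeoConsts) (P : SplitConsts) (r β U μ : ℝ) (n : ℕ) (D : Matrix (HubbardFieldIdx L M) (HubbardFieldIdx L M) ℂ) : Prop :=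
  ∀ Qm : TorusSite 2 L, IsPairClassAt L Qm n →
    ∃ t : TorusSite 2 L → ℝ, (∑ p, |t p| ≤ G.bhi / 4) ∧ (∑ p, (|t p| + t p) ≤ klEdge G n (klTorusNorm L Qm)) ∧
      ∃ Mt : Matrix (TorusSite 2 L) (TorusSite 2 L) ℂ,
        (1 - Matrix.diagonal (fun p => (t p : ℂ)) * klPairArrayF L M β U μ n Qm) * Mt = 1 ∧
        ∀ k ∈ klBall L μ 0, ∀ k' ∈ klBall L μ 0,
          ‖klCovSmearedPairAmplitude L M β U μ (klFlowFrameU L M β U μ n) n D Qm k k' - (klPairArrayF L M β U μ n Qm * Mt) k k'‖ ≤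
            transferBarAt L G P r β U n Qm k k'

/-- **`PairTransferFamilyCov L M G P r β U μ n`** := the clause at EVERY admissible smearing covariance of the frame `K_n` at scale `n` — the invariant the one-slice
induction carries (RECOMMENDED form, (q6)): it contains the door's member (`D = D_n`: `.pairTransferAt`), every `D_m` (`.sm`), the plain member (`D = 0`) and the
gapped members the next step consumes. -/
def PairTransferFamilyCov (G : GeoConsts) (P : SplitConsts) (r β U μ : ℝ) (n : ℕ) : Prop :=
  ∀ D : Matrix (HubbardFieldIdx L M) (HubbardFieldIdx L M) ℂ, IsSoftSubCov L M β μ (klFlowFrameU L M β U μ n) n D →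
    PairTransferAtCov L M G P r β U μ n D

/-- **`PairTransferAt L M G P r β U μ n`** := the member `D = D^{K_n}_n` — internal export class #5 «(S)-transfer» in the DOOR's form (`pairTransferAt_iff`):
for every pair class `Qm` at resolution `n`, a transfer weight `t` (door sign convention; `t ≤ 0` up to the edge) of mass `≤ G.bhi/4` and near-nonpositivity
`Σ(|t| + t) ≤ klEdge G n |Qm|_𝕋`, a two-sided inverse `M` of `1 − diag t·klPairArrayF n Qm`, and ON THE BARE BALL
`‖𝒞^W_n(Qm; k, k′) − (klPairArrayF n Qm · M) k k′‖ ≤ transferBarAt … n Qm k k′`. -/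
def PairTransferAt (G : GeoConsts) (P : SplitConsts) (r β U μ : ℝ) (n : ℕ) : Prop :=
  PairTransferAtCov L M G P r β U μ n (klSoftCov L M β μ (klFlowFrameU L M β U μ n) n)

omit [NeZero M] in
/-- **The hard covariance between two scales is admissible**: `D^K_n − D^K_m = C^K_{(Λ_m, Λ_n]}` for `m ≥ n` (symbol fraction `w^K_{Λ_m} − w^K_{Λ_n} ∈ [0, 1 − w^K_{Λ_n}]`)
— the COMPLEMENTARY scale family: `m = n` is `0` (the PLAIN member), `m` past the thermal scale is `D^K_n` (the WICK member), and the steps consume exactly these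
members with the SAME index (`klSoftCov_succ_sub_add_slice`). -/
theorem isSoftSubCov_softCov_sub (β μ : ℝ) (K : TrigPolyC4v) {n m : ℕ} (hnm : n ≤ m) :
    IsSoftSubCov L M β μ K n (klSoftCov L M β μ K n - klSoftCov L M β μ K m) := by
  refine ⟨fun ks => hubbardCutoffWeightCT L M β μ K (klScale klE0 m) ks.1 - hubbardCutoffWeightCT L M β μ K (klScale klE0 n) ks.1,
    fun ks => ⟨?_, ?_⟩, ?_⟩
  · -- `w_{Λ_n} ≤ w_{Λ_m}` since `Λ_m ≤ Λ_n`
    have hE0 : (0 : ℝ) ≤ klE0 := by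
      have h0 := klth_klScale_pos 0
      unfold klScale at h0
      simpa using h0.le
    have hΛ : klScale klE0 m ≤ klScale klE0 n := by
      unfold klScale
      exact mul_le_mul_of_nonneg_left (inv_anti₀ (by positivity) (pow_le_pow_right₀ (by norm_num) hnm)) hE0
    have hw : hubbardCutoffWeightCT L M β μ K (klScale klE0 n) ks.1 ≤ hubbardCutoffWeightCT L M β μ K (klScale klE0 m) ks.1 := by
      unfold hubbardCutoffWeightCT
      refine monotone_salmhoferCutoff ?_
      have hE : 0 ≤ matsubaraFreq β M ks.1.1 ^ 2 + nambuXiCT L μ K ks.1.2 ^ 2 := by positivity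
      exact div_le_div_of_nonneg_left hE (by have := klth_klScale_pos m; positivity) (pow_le_pow_left₀ (klth_klScale_pos m).le hΛ 2)
    linarith
  · have h : hubbardCutoffWeightCT L M β μ K (klScale klE0 m) ks.1 ≤ 1 := (salmhoferCutoff_mem_Icc _).2
    linarith
  · rw [klw_softCov_eq_normalCovariance, klw_softCov_eq_normalCovariance, ← normalCovariance_sub_symbol]
    congr 1
    funext ks
    push_cast
    ring

omit [NeZero L] [NeZero M] in
/-- **Closure of the complementary family under the step**: `(D_{n+1} − D_m) + g_{n+1} = D_n − D_m` — the step `n → n+1` maps the scale-`(n+1)` member of index `m` to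
the scale-`n` member of the SAME index (`klw_smearedAction_succ`, `…WickSmearedFamilyStep`: `e^{Δ_D}𝒱_{n+1} = e^{Δ_{D+g_{n+1}}}𝒱_n − …`). -/
theorem klSoftCov_succ_sub_add_slice (β μ : ℝ) (K : TrigPolyC4v) (n m : ℕ) :
    klSoftCov L M β μ K (n + 1) - klSoftCov L M β μ K m + klSliceCov L M β μ K (n + 1) = klSoftCov L M β μ K n - klSoftCov L M β μ K m := by
  rw [klw_softCov_eq_succ_add_slice L M β μ K n]; abel

/-- **`PairTransferFamilyHard L M G P r β U μ n`** := the clause at every complementary member `D_n − D_m`, `m ≥ n` — the MINIMAL induction-carrying family: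
what the one-parameter family of step towers consumes and produces (KL STATUS 15:04Z (3)); contained in `PairTransferFamilyCov` (`PairTransferFamilyCov.hard`). -/
def PairTransferFamilyHard (G : GeoConsts) (P : SplitConsts) (r β U μ : ℝ) (n : ℕ) : Prop :=
  ∀ m : ℕ, n ≤ m →
    PairTransferAtCov L M G P r β U μ n
      (klSoftCov L M β μ (klFlowFrameU L M β U μ n) n - klSoftCov L M β μ (klFlowFrameU L M β U μ n) m)

variable {L M}

/-- The door's form, literally: `PairTransferAt` unfolded with `klWickPairAmplitude` (`𝒞^W_n = 𝒱₄(e^{Δ_{D_n}}𝒱_n)` by `rfl`). -/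
theorem pairTransferAt_iff {G : GeoConsts} {P : SplitConsts} {r β U μ : ℝ} {n : ℕ} :
    PairTransferAt L M G P r β U μ n ↔
      ∀ Qm : TorusSite 2 L, IsPairClassAt L Qm n →
        ∃ t : TorusSite 2 L → ℝ, (∑ p, |t p| ≤ G.bhi / 4) ∧ (∑ p, (|t p| + t p) ≤ klEdge G n (klTorusNorm L Qm)) ∧
          ∃ Mt : Matrix (TorusSite 2 L) (TorusSite 2 L) ℂ,
            (1 - Matrix.diagonal (fun p => (t p : ℂ)) * klPairArrayF L M β U μ n Qm) * Mt = 1 ∧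
            ∀ k ∈ klBall L μ 0, ∀ k' ∈ klBall L μ 0,
              ‖klWickPairAmplitude L M β U μ (klFlowFrameU L M β U μ n) n Qm k k' - (klPairArrayF L M β U μ n Qm * Mt) k k'‖ ≤
                transferBarAt L G P r β U n Qm k k' :=
  Iff.rfl

/-- The covariance family contains the complementary scale family … -/
theorem PairTransferFamilyCov.hard {G : GeoConsts} {P : SplitConsts} {r β U μ : ℝ} {n : ℕ} (h : PairTransferFamilyCov L M G P r β U μ n) :
    PairTransferFamilyHard L M G P r β U μ n :=
  fun _ hm => h _ (isSoftSubCov_softCov_sub L M β μ _ hm)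

/-- … and the door's member (`D = D_n`, admissible by `isSoftSubCov_klSoftCov`). -/
theorem PairTransferFamilyCov.pairTransferAt {G : GeoConsts} {P : SplitConsts} {r β U μ : ℝ} {n : ℕ} (h : PairTransferFamilyCov L M G P r β U μ n) :
    PairTransferAt L M G P r β U μ n :=
  h _ (isSoftSubCov_klSoftCov L M β μ _ le_rfl)

/-- Monotonicity of the clause in `r`. -/
theorem PairTransferAtCov.mono {G : GeoConsts} (hph : ∀ n ρ, 0 ≤ G.phGain n ρ) (hCF : 0 ≤ G.CF) {P : SplitConsts} (hK : 0 ≤ P.Klam) {r r' β U μ : ℝ}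
    {n : ℕ} {D : Matrix (HubbardFieldIdx L M) (HubbardFieldIdx L M) ℂ} (h : PairTransferAtCov L M G P r β U μ n D) (hr : r ≤ r') :
    PairTransferAtCov L M G P r' β U μ n D := by
  intro Qm hQm
  obtain ⟨t, hmass, hneg, Mt, hM, hbd⟩ := h Qm hQm
  exact ⟨t, hmass, hneg, Mt, hM, fun k hk k' hk' => (hbd k hk k' hk').trans (transferBarAt_mono hph hCF hK hr β U n Qm k k')⟩

/-- Monotonicity of the family in `r`. -/
theorem PairTransferFamilyCov.mono {G : GeoConsts} (hph : ∀ n ρ, 0 ≤ G.phGain n ρ) (hCF : 0 ≤ G.CF) {P : SplitConsts} (hK : 0 ≤ P.Klam) {r r' β U μ : ℝ}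
    {n : ℕ} (h : PairTransferFamilyCov L M G P r β U μ n) (hr : r ≤ r') : PairTransferFamilyCov L M G P r' β U μ n :=
  fun D hD => (h D hD).mono hph hCF hK hr

end Model

/-! ## §1′ The two bookkeeping inequalities the door's composite weight `w₁ + b − b′` uses -/

/-- **Subadditivity of the negative part**: `Σ(|a+b| − (a+b)) ≤ Σ(|a| − a) + Σ(|b| − b)`; with `b := −b′` the second summand is the near-NONPOSITIVITY
mass `Σ(|b′| + b′)` of the history's transfer weight. -/
theorem sum_negPart_add_le {ι : Type*} (s : Finset ι) (a b : ι → ℝ) :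
    ∑ i ∈ s, (|a i + b i| - (a i + b i)) ≤ ∑ i ∈ s, (|a i| - a i) + ∑ i ∈ s, (|b i| - b i) := by
  rw [← sum_add_distrib]
  exact sum_le_sum fun i _ => by have := abs_add_le (a i) (b i); linarith

/-- The composite's negative part against the three producers: `Σ(|w+b−b′| − (w+b−b′)) ≤ Σ(|w+b| − (w+b)) + Σ(|b′| + b′)`. -/
theorem sum_negPart_composite_le {ι : Type*} (s : Finset ι) (w b b' : ι → ℝ) :
    ∑ i ∈ s, (|w i + b i - b' i| - (w i + b i - b' i)) ≤ ∑ i ∈ s, (|w i + b i| - (w i + b i)) + ∑ i ∈ s, (|b' i| + b' i) := by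
  have h := sum_negPart_add_le s (fun i => w i + b i) (fun i => -b' i)
  simp only [abs_neg, sub_neg_eq_add, ← sub_eq_add_neg] at h
  exact h

/-- The composite's mass: `Σ|w + b − b′| ≤ Σ|w| + Σ|b| + Σ|b′|`. -/
theorem sum_abs_add_sub_le {ι : Type*} (s : Finset ι) (w b b' : ι → ℝ) :
    ∑ i ∈ s, |w i + b i - b' i| ≤ ∑ i ∈ s, |w i| + ∑ i ∈ s, |b i| + ∑ i ∈ s, |b' i| := by
  rw [← sum_add_distrib, ← sum_add_distrib]
  exact sum_le_sum fun i _ => by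
    have h1 := abs_add_le (w i + b i) (-b' i); have h2 := abs_add_le (w i) (b i)
    rw [abs_neg, ← sub_eq_add_neg] at h1; linarith

/-! ## §2 The step Prop -/

/-- **`PairTransferStep P R Q₀ r u`** — class #5's induction step: for every geometry package `G` (`G.WF`), every raised `CR`-value `rr ≥ Q₀.CR`, under the stub
binders of the engine-flow skeleton (doors `klEngC₃6`, `klEngU₀9`, `klEngL₃`, `klEngM₃`) and below the step's own deferred threshold `u rr cc`: the history at
`Q₀.withCR rr`, the admissibility of `K_n`, the NORM exports at every `j ≤ n` (class #1's deferred table `klCU P R Q₀`) and the TRANSFER exports at every `j < n` give the transfer export at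
`n`.  (At `n = 0` the transfer history is empty: the scale-`0` transfer is the scale-`0` lane's obligation.) -/
def PairTransferStep (P : SplitConsts) (R : RenConsts) (Q₀ : EngConsts) (r : ℝ) (u : ℝ → ℝ → ℝ) : Prop :=
  ∀ G : GeoConsts, G.WF → ∀ rr : ℝ, Q₀.CR ≤ rr →
    ∀ cc : ℝ, 0 < cc → cc ≤ klEngC₃6 P R →
      ∀ μ ∈ klWindowC, ∀ U : ℝ, 0 < U → U ≤ klEngU₀9 P R cc → U ≤ u rr cc →
        ∀ β : ℝ, klBetaMin ≤ β → β ≤ Real.exp (cc / U ^ 2) →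
          ∀ (L M : ℕ) [NeZero L] [NeZero M], klEngL₃ β U ≤ L → klEngM₃ β U L ≤ M →
            ∀ n : ℕ, n ≤ nScales β + 1 → IsKLRegime U cc (-(n : ℤ)) →
              HistP klPredsV17F2 L M G P (Q₀.withCR rr) R β U μ 0 n →
                FrameOK R U (nScales β) μ (klFlowFrameU L M β U μ n) →
                  (∀ j ≤ n, LevelsUExportAt L M (klCU P R Q₀) P β U μ j) →
                    (∀ j < n, PairTransferFamilyCov L M G P r β U μ j) →
                      PairTransferFamilyCov L M G P r β U μ n

/-- **An admissible transfer package**: a nonnegative constant `r` and a POSITIVE threshold function `u`. -/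
def IsTransferPkg (e : ℝ × (ℝ → ℝ → ℝ)) : Prop := 0 ≤ e.1 ∧ ∀ rr cc, 0 < e.2 rr cc

/-- The trivial package (`r = 0`, threshold `1`) is admissible. -/
theorem isTransferPkg_zero : IsTransferPkg (0, fun _ _ => 1) := ⟨le_rfl, fun _ _ => one_pos⟩

/-! ## §3 The deferred constant and threshold -/

section Deferred

variable (P : SplitConsts) (R : RenConsts) (Q₀ : EngConsts)

/-- The deferred transfer package: SOME admissible `(r, u)` for which the step holds, if one exists, else the trivial package. -/
def klTransferPkg : ℝ × (ℝ → ℝ → ℝ) :=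
  open scoped Classical in
  if h : ∃ e : ℝ × (ℝ → ℝ → ℝ), IsTransferPkg e ∧ PairTransferStep P R Q₀ e.1 e.2 then Classical.choose h else (0, fun _ _ => 1)

/-- **The deferred transfer constant `klCT P R Q₀`** — a closed term today, adequate the day `PairTransferStep P R Q₀ r u` is proved for any admissible package
(then `pairTransferStep_klCT_of_exists`); the v2 skeleton reads it at `c := klCU P R Q₀`. -/
def klCT : ℝ := (klTransferPkg P R Q₀).1

/-- **The deferred coupling threshold `klCTu P R Q₀ rr cc`** of the transfer step (the v2 U-door takes `min` with it). -/
def klCTu : ℝ → ℝ → ℝ := (klTransferPkg P R Q₀).2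

/-- The deferred package is admissible (unconditionally). -/
theorem isTransferPkg_klTransferPkg : IsTransferPkg (klTransferPkg P R Q₀) := by
  classical
  unfold klTransferPkg
  split_ifs with h
  · exact (Classical.choose_spec h).1
  · exact isTransferPkg_zero

/-- `0 ≤ klCT P R Q₀` (unconditionally). -/
theorem klCT_nonneg : 0 ≤ klCT P R Q₀ := (isTransferPkg_klTransferPkg P R Q₀).1

/-- `0 < klCTu P R Q₀ rr cc` (unconditionally) — so a `min` with it keeps a U-door positive. -/
theorem klCTu_pos (rr cc : ℝ) : 0 < klCTu P R Q₀ rr cc := (isTransferPkg_klTransferPkg P R Q₀).2 rr cc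

variable {P R Q₀}

/-- **The step holds for the deferred package as soon as it holds for some admissible package.** -/
theorem pairTransferStep_klCT_of_exists (h : ∃ e : ℝ × (ℝ → ℝ → ℝ), IsTransferPkg e ∧ PairTransferStep P R Q₀ e.1 e.2) :
    PairTransferStep P R Q₀ (klCT P R Q₀) (klCTu P R Q₀) := by
  classical
  have hpkg : klTransferPkg P R Q₀ = Classical.choose h := by
    unfold klTransferPkg
    rw [dif_pos h]
  unfold klCT klCTu
  rw [hpkg]
  exact (Classical.choose_spec h).2

/-- Packaging an explicit witness. -/
theorem pairTransferStep_klCT_of {r : ℝ} {u : ℝ → ℝ → ℝ} (hr : 0 ≤ r) (hu : ∀ rr cc, 0 < u rr cc) (hs : PairTransferStep P R Q₀ r u) :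
    PairTransferStep P R Q₀ (klCT P R Q₀) (klCTu P R Q₀) :=
  pairTransferStep_klCT_of_exists ⟨(r, u), ⟨hr, hu⟩, hs⟩

end Deferred

end Summit.HubbardSuperconductivity.HubbardSuperconductivity.Theorems.KLRegimeSplit

end
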